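import Summits.AtomisticToContinuum.HydrodynamicLimit.Theorems.TwoClocksEquilibriumFastWindowLDBirthVelTelescope
import HarnessLib

/-!
# Position–velocity telescoping of one-particle functionals along the hard-sphere flow:
# own-collision jumps plus free-flight transport, and the derivative-free Lipschitz bound of the
# transport (helpers `ccb7_posvel_telescope_le`, `ccb7_comp_vel_intervalIntegrable` of the line
# `birth`, crux `TwoClocks.EquilibriumFastWindowLD`, stmt-AtomisticToContinuum-14440)

Along a hard-sphere trajectory `γ` particle `i` alternates FREE FLIGHTS (its velocity `v_i` is
constant and its position moves by `x ↦ G.translate x (t • v_i)`, `IsHardSphereTrajectory.free`)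
and OWN COLLISIONS (its velocity jumps, its position is continuous,
`IsHardSphereTrajectory.leftLim_apply_fst`); collisions of other pairs do not affect `(x_i, v_i)`.
For a functional `f x v` of POSITION AND VELOCITY (the corrector `ĝ(x_i, v_i)` of the transfer
stub `stub_correctorTransfer`, identity (★)) the finite difference
`f (x_i(b), v_i(b)) - f (x_i(a), v_i(a))` therefore splits into

* the OWN-COLLISION JUMPS `Σ_{records c in (a, b], fst = i} (f (x_c, v⁺) - f (x_c, v⁻))`, a plain
  `collisionSum` with the record position `c.fstPos = x_i(t_c)` — this collision sum IS the sum of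
  the jumps of the observable `F_i w = f (w i).1 (w i).2` (`collisionalTransfer`), because positions
  do not jump and third particles do not jump
  (`collisionSum_ite_fst_posVel_eq_collisionalTransfer`, the exact identity); and
* the FLIGHT TERMS `Σ_flights (f (x_end, v) - f (x_start, v))` (`= F_i(γ b) - F_i(γ a) -
  collisionalTransfer F_i`; for `f` differentiable along flights this is the streaming integral of
  the weak balance law `IsHardSphereTrajectory.sub_eq_integral_add_collisionalTransfer`).

The transfer only needs the flight terms BOUNDED, derivative-free: if `f` grows along free
flight at rate `k`, `‖f (G.translate x (t • v)) v - f x v‖ ≤ t · k v` (`t ≥ 0`; on `𝕋³`: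
`|f x v - f x' v| ≤ K v · dist x x'` gives `k v = K v ‖v‖`), then

  `‖f (x_i b, v_i b) - f (x_i a, v_i a) - Σ_{(a,b], fst = i} (f (x_c, v⁺) - f (x_c, v⁻))‖
      ≤ ∫_a^b k (v_i t) dt`

(`norm_sub_sub_collisionSum_le`; first-collision induction on the window, `window_induction`,
as in the weak balance law). Since `v_i` is piecewise constant, `t ↦ g (v_i t)` is interval
integrable for EVERY `g` (`intervalIntegrable_comp_vel`). Flow forms on `𝕋³` (`0 < σ < 1/2`,
`z ∈ Φ.good`): `ccb7_posvel_telescope_le` (registered; `f : T3 → V3 → ℝ`, `dist`-Lipschitz in `x`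
with modulus `K v`, bound `∫_a^b K (v_i t) ‖v_i t‖ dt`) and `ccb7_comp_vel_intervalIntegrable`
(registered). This generalises the velocity-only telescoping `apply_vel_sub_eq_collisionSum`
(file `…BirthVelTelescope`) to position-dependent functionals; it is the pathwise transport
estimate of the corrector identity (★) of the line `birth` (x-Lipschitz corrector, no
mollification).

References: Cercignani–Illner–Pulvirenti 1994 §4.2; Gallagher–Saint-Raymond–Texier 2013 §4.1;
Spohn 1991 Part I §3.2 (weak balance laws along trajectories).
-/

noncomputable section

open MeasureTheory Set Filter Function
open scoped ENNReal BigOperators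

namespace Summit.AtomisticToContinuum.HydrodynamicLimit.Theorems.ClampedCorrectorBirth

open Literature.Analysis.FluidPDE Literature.MathematicalPhysics.KineticTheory

section Trajectory

variable {d : Type*} [Fintype d] {X : Type*} [TopologicalSpace X] {n : ℕ}
  {G : Geometry d X} {ε : ℝ} {γ : ℝ → Config n d X}
  {E : Type*} [NormedAddCommGroup E]

/-- **First-collision induction on a time window.** To prove a property `P a b` of the windows
`[a, b]` (`a ≤ b`) of a hard-sphere trajectory it suffices to prove it (i) for windows without
collision in `(a, b]` and (ii) for a window whose FIRST collision time `T ∈ (a, b]` is given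
(`(a, T)` collision-free) assuming it for `[T, b]`: induction on the finite number of collision
times in `(a, b]` (`IsHardSphereTrajectory.locFinite`), as in the weak balance law
`IsHardSphereTrajectory.sub_eq_integral_add_collisionalTransfer`. -/
theorem window_induction (h : IsHardSphereTrajectory G ε n γ) {P : ℝ → ℝ → Prop}
    (hfree : ∀ a b : ℝ, a ≤ b → (∀ s ∈ Ioc a b, s ∉ collisionTimes G ε γ) → P a b)
    (hstep : ∀ a T b : ℝ, a < T → T ≤ b → T ∈ collisionTimes G ε γ →
      (∀ s ∈ Ioo a T, s ∉ collisionTimes G ε γ) → P T b → P a b)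
    {a b : ℝ} (hab : a ≤ b) : P a b := by
  -- adapted from `IsHardSphereTrajectory.sub_eq_integral_add_collisionalTransfer`
  classical
  suffices H : ∀ (m : ℕ) (a : ℝ), a ≤ b →
      (h.finite_collisionTimes_inter_Ioc a b).toFinset.card = m → P a b from H _ a hab rfl
  intro m
  induction m with
  | zero =>
    intro a hab hcard
    rw [Finset.card_eq_zero] at hcard
    exact hfree a b hab fun s hs hcol =>
      Finset.notMem_empty s (hcard ▸ (Set.Finite.mem_toFinset _).2 ⟨hcol, hs⟩)
  | succ m ih =>
    intro a hab hcard
    set S := (h.finite_collisionTimes_inter_Ioc a b).toFinset with hS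
    have hne : S.Nonempty := Finset.card_pos.1 (by omega)
    have hTmem : S.min' hne ∈ collisionTimes G ε γ ∩ Ioc a b :=
      (Set.Finite.mem_toFinset _).1 (S.min'_mem hne)
    set T := S.min' hne with hT
    have haT : a < T := hTmem.2.1
    have hTb : T ≤ b := hTmem.2.2
    have hmemS : ∀ {s}, s ∈ collisionTimes G ε γ → a < s → s ≤ b → s ∈ S :=
      fun hs has hsb => (Set.Finite.mem_toFinset _).2 ⟨hs, has, hsb⟩
    have hfree' : ∀ s ∈ Ioo a T, s ∉ collisionTimes G ε γ := fun s hs hcol =>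
      (not_lt.2 (S.min'_le s (hmemS hcol hs.1 (hs.2.le.trans hTb)))) hs.2
    -- the window `(T, b]` carries the remaining `m` collision times
    have hcard' : (h.finite_collisionTimes_inter_Ioc T b).toFinset.card = m := by
      have hE : (h.finite_collisionTimes_inter_Ioc T b).toFinset = S.erase T := by
        ext s
        simp only [Set.Finite.mem_toFinset, Finset.mem_erase, mem_inter_iff, mem_Ioc]
        constructor
        · rintro ⟨hs, hTs, hsb⟩
          exact ⟨hTs.ne', hmemS hs (haT.trans hTs) hsb⟩
        · rintro ⟨hne', hsS⟩
          obtain ⟨hs, has, hsb⟩ := (Set.Finite.mem_toFinset _).1 hsS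
          exact ⟨hs, lt_of_le_of_ne (S.min'_le s hsS) (Ne.symm hne'), hsb⟩
      rw [hE, Finset.card_erase_of_mem (S.min'_mem hne), hcard]
      rfl
    exact hstep a T b haT hTb hTmem.1 hfree' (ih T hTb hcard')

/-- On a window `[a, s]` without collision in `(a, s]` particle `i` flies freely: its velocity is
`v_i(a)` and its position is `x_i(a)` translated by `(s - a) • v_i(a)`. -/
theorem apply_eq_of_Ioc_free (h : IsHardSphereTrajectory G ε n γ) {a s : ℝ} (has : a ≤ s)
    (hfree : ∀ σ ∈ Ioc a s, σ ∉ collisionTimes G ε γ) (i : Fin n) :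
    γ s i = (G.translate (γ a i).1 ((s - a) • (γ a i).2), (γ a i).2) := by
  rw [h.free a s has hfree, freeFlight_apply]

/-- **Every function of one velocity is interval integrable along a hard-sphere trajectory.**
The velocity of particle `i` is piecewise constant on every bounded window (constant on each
collision-free stretch, finitely many collision times), so `t ↦ g (v_i(t))` is a step function:
interval integrable on `[a, b]` for EVERY `g` (no measurability or growth condition). -/
theorem intervalIntegrable_comp_vel (h : IsHardSphereTrajectory G ε n γ)
    (g : EuclideanSpace ℝ d → E) (i : Fin n) (a b : ℝ) :
    IntervalIntegrable (fun s => g (γ s i).2) volume a b := by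
  have aux : ∀ {a b : ℝ}, a ≤ b → IntervalIntegrable (fun s => g (γ s i).2) volume a b := by
    intro a b hab
    refine window_induction h (P := fun a b => IntervalIntegrable (fun s => g (γ s i).2) volume a b)
      (fun a b hab hfree => ?_) (fun a T b haT _ _ hfree ih => IntervalIntegrable.trans ?_ ih) hab
    · refine (intervalIntegrable_const (c := g (γ a i).2)).congr_uIoo fun s hs => ?_
      rw [uIoo_of_le hab] at hs
      show g (γ a i).2 = g (γ s i).2
      rw [apply_eq_of_Ioc_free h hs.1.le (fun σ hσ => hfree σ ⟨hσ.1, hσ.2.trans hs.2.le⟩) i]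
    · refine (intervalIntegrable_const (c := g (γ a i).2)).congr_uIoo fun s hs => ?_
      rw [uIoo_of_le haT.le] at hs
      show g (γ a i).2 = g (γ s i).2
      rw [h.eq_freeFlight_of_Ioo_free hfree ⟨hs.1.le, hs.2⟩, freeFlight_apply]
  rcases le_total a b with hab | hba
  · exact aux hab
  · exact (aux hba).symm

/-- The integral of a function of the velocity of particle `i` over a window `[a, b]` on whose
interior the trajectory is the free flight of `γ a`: `∫_a^b g (v_i s) ds = (b - a) • g (v_i a)`. -/
theorem integral_comp_vel_eq_of_Ioo_free [NormedSpace ℝ E] [CompleteSpace E]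
    (h : IsHardSphereTrajectory G ε n γ) (g : EuclideanSpace ℝ d → E) (i : Fin n) {a b : ℝ}
    (hab : a ≤ b) (hfree : ∀ σ ∈ Ioo a b, σ ∉ collisionTimes G ε γ) :
    ∫ s in a..b, g (γ s i).2 = (b - a) • g (γ a i).2 := by
  have heq : EqOn (fun s => g (γ s i).2) (fun _ => g (γ a i).2) (Ioo a b) := fun s hs => by
    show g (γ s i).2 = g (γ a i).2
    rw [h.eq_freeFlight_of_Ioo_free hfree ⟨hs.1.le, hs.2⟩, freeFlight_apply]
  rw [intervalIntegral.integral_congr_Ioo_of_le hab heq, intervalIntegral.integral_const]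

/-- **The record increment of `f (x_i, v_i)` at a collision time is the jump in the velocity slot.**
At a collision time `t` of a hard-sphere trajectory in a regular geometry, for every functional
`f` of position and velocity, the sum over the ordered contact pairs `p` of
`if p.1 = i then f x_{p.1} v_{p.1}⁺ - f x_{p.1} v_{p.1}⁻ else 0` (record position `fstPos`) is
`f (x_i t) (v_i t) - f (x_i t) (v_i t⁻)` (the velocity-only lemma
`sum_contactPairs_ite_fst_apply_eq_jump` applied to `f (x_i t)`). -/
theorem sum_contactPairs_ite_fst_posVel_eq_jump [T2Space X] (h : IsHardSphereTrajectory G ε n γ)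
    (hG : G.IsHardSphereRegular ε) {t : ℝ} (ht : t ∈ collisionTimes G ε γ)
    (f : X → EuclideanSpace ℝ d → E) (i : Fin n) :
    ∑ p ∈ contactPairs G ε (γ t),
        (if (HardSphereCollisionRecord.ofConfig G ε (γ t) t p.1 p.2).fst = i then
          f (HardSphereCollisionRecord.ofConfig G ε (γ t) t p.1 p.2).fstPos
              (HardSphereCollisionRecord.ofConfig G ε (γ t) t p.1 p.2).postVel.1 -
            f (HardSphereCollisionRecord.ofConfig G ε (γ t) t p.1 p.2).fstPos
              (HardSphereCollisionRecord.ofConfig G ε (γ t) t p.1 p.2).preVel.1 else 0) =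
      f (γ t i).1 (γ t i).2 - f (γ t i).1 (leftLim γ t i).2 := by
  rw [← sum_contactPairs_ite_fst_apply_eq_jump h hG ht (f (γ t i).1) i]
  refine Finset.sum_congr rfl fun p _ => ?_
  simp only [HardSphereCollisionRecord.ofConfig_fst, HardSphereCollisionRecord.ofConfig_fstPos]
  split_ifs with hp
  · rw [hp]
  · rfl

/-- **The exact identity: the own-collision sum with positions is the jump sum of `F_i`.** Along
a hard-sphere trajectory in a regular geometry, for every functional `f` of position and velocity,
every particle `i` and every window `(a, b]`: the collision sum over the records with `fst = i` of
`f (x_c, v⁺) - f (x_c, v⁻)` (record position `c.fstPos = x_i(t_c)`) equals the collisional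
transfer (sum of the jumps `F_i(γ t) - F_i(γ t⁻)` over the collision times `t ∈ (a, b]`) of the
observable `F_i w = f (w i).1 (w i).2` — positions do not jump (`leftLim_apply_fst`) and third
particles do not jump. Consequently `F_i(γ b) - F_i(γ a) - (this collision sum)` is exactly the
sum of the FLIGHT TERMS `f (x_end, v) - f (x_start, v)` over the free flights of `i` in `[a, b]`. -/
theorem collisionSum_ite_fst_posVel_eq_collisionalTransfer [T2Space X]
    (h : IsHardSphereTrajectory G ε n γ) (hG : G.IsHardSphereRegular ε)
    (f : X → EuclideanSpace ℝ d → E) (i : Fin n) (a b : ℝ) :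
    collisionSum G ε γ (Ioc a b)
        (fun c => if c.fst = i then f c.fstPos c.postVel.1 - f c.fstPos c.preVel.1 else 0) =
      collisionalTransfer G ε (fun w => f (w i).1 (w i).2) γ a b := by
  rw [collisionalTransfer, collisionSum_eq_collisionPairSum, collisionPairSum]
  refine finsum_mem_congr rfl fun t ht => ?_
  rw [sum_contactPairs_ite_fst_posVel_eq_jump h hG ht.1 f i, collisionJump,
    h.leftLim_apply_fst hG.continuous_translate_left t i]

/-- **Telescoping with flight terms, bounded derivative-free (jump-sum form).** Along a
hard-sphere trajectory (Hausdorff positions, continuous translations), let `f x v` grow along free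
flight at rate at most `k v`: `‖f (G.translate x (t • v)) v - f x v‖ ≤ t * k v` for `t ≥ 0`. Then
for every particle `i` and `a ≤ b`,
`‖F_i(γ b) - F_i(γ a) - collisionalTransfer F_i‖ ≤ ∫_a^b k (v_i s) ds`, `F_i w = f (w i).1 (w i).2`:
the left-hand side is the sum of the flight terms, each bounded by `(length) · k (flight velocity)`
(first-collision induction `window_induction`; on the stretch before the first collision `T` the
left limit is the free flight of `γ a`, `leftLim_eq_freeFlight`, and the transfer over `(a, T]` is
the jump at `T`, `collisionalTransfer_eq_collisionJump`). -/
theorem norm_sub_sub_collisionalTransfer_le [T2Space X] (h : IsHardSphereTrajectory G ε n γ)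
    (hG : ∀ x : X, Continuous (G.translate x)) (f : X → EuclideanSpace ℝ d → E)
    {k : EuclideanSpace ℝ d → ℝ}
    (hk : ∀ (x : X) (v : EuclideanSpace ℝ d) (t : ℝ), 0 ≤ t →
      ‖f (G.translate x (t • v)) v - f x v‖ ≤ t * k v)
    (i : Fin n) {a b : ℝ} (hab : a ≤ b) :
    ‖f (γ b i).1 (γ b i).2 - f (γ a i).1 (γ a i).2 -
        collisionalTransfer G ε (fun w => f (w i).1 (w i).2) γ a b‖ ≤
      ∫ s in a..b, k (γ s i).2 := by
  refine window_induction h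
    (P := fun a b => ‖f (γ b i).1 (γ b i).2 - f (γ a i).1 (γ a i).2 -
      collisionalTransfer G ε (fun w => f (w i).1 (w i).2) γ a b‖ ≤ ∫ s in a..b, k (γ s i).2)
    (fun a b hab hfree => ?_) (fun a T b haT hTb hT hfree ih => ?_) hab
  · -- no collision in `(a, b]`: one free flight of length `b - a`
    rw [collisionalTransfer_eq_zero_of_forall_not_mem _ hfree, sub_zero,
      integral_comp_vel_eq_of_Ioo_free h k i hab (fun σ hσ => hfree σ ⟨hσ.1, hσ.2.le⟩),
      smul_eq_mul, apply_eq_of_Ioc_free h hab hfree i]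
    exact hk _ _ _ (sub_nonneg.2 hab)
  · -- first collision at `T`: the flight `[a, T]`, the jump at `T`, and the window `[T, b]`
    have hint₁ : IntervalIntegrable (fun s => k (γ s i).2) volume a T :=
      intervalIntegrable_comp_vel h k i a T
    have hint₂ : IntervalIntegrable (fun s => k (γ s i).2) volume T b :=
      intervalIntegrable_comp_vel h k i T b
    have hflight : ‖f (leftLim γ T i).1 (leftLim γ T i).2 - f (γ a i).1 (γ a i).2‖ ≤
        ∫ s in a..T, k (γ s i).2 := by
      rw [integral_comp_vel_eq_of_Ioo_free h k i haT.le hfree, smul_eq_mul,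
        h.leftLim_eq_freeFlight hG haT hfree, freeFlight_apply]
      exact hk _ _ _ (sub_nonneg.2 haT.le)
    rw [← intervalIntegral.integral_add_adjacent_intervals hint₁ hint₂,
      ← h.collisionalTransfer_add_adjacent (fun w => f (w i).1 (w i).2) haT.le hTb,
      collisionalTransfer_eq_collisionJump _ haT hT hfree, collisionJump]
    calc ‖f (γ b i).1 (γ b i).2 - f (γ a i).1 (γ a i).2 -
          (f (γ T i).1 (γ T i).2 - f (leftLim γ T i).1 (leftLim γ T i).2 +
            collisionalTransfer G ε (fun w => f (w i).1 (w i).2) γ T b)‖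
        = ‖f (leftLim γ T i).1 (leftLim γ T i).2 - f (γ a i).1 (γ a i).2 +
            (f (γ b i).1 (γ b i).2 - f (γ T i).1 (γ T i).2 -
              collisionalTransfer G ε (fun w => f (w i).1 (w i).2) γ T b)‖ := by
          congr 1
          abel
      _ ≤ ‖f (leftLim γ T i).1 (leftLim γ T i).2 - f (γ a i).1 (γ a i).2‖ +
            ‖f (γ b i).1 (γ b i).2 - f (γ T i).1 (γ T i).2 -
              collisionalTransfer G ε (fun w => f (w i).1 (w i).2) γ T b‖ := norm_add_le _ _
      _ ≤ (∫ s in a..T, k (γ s i).2) + ∫ s in T..b, k (γ s i).2 := add_le_add hflight ih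

/-- **Telescoping with flight terms, bounded derivative-free (collision-sum form).** Along a
hard-sphere trajectory in a regular geometry, for `f` growing along free flight at rate `k`
(`‖f (G.translate x (t • v)) v - f x v‖ ≤ t * k v`, `t ≥ 0`), every particle `i` and `a ≤ b`:
`‖f (x_i b, v_i b) - f (x_i a, v_i a) - Σ_{records in (a, b], fst = i} (f (x_c, v⁺) - f (x_c, v⁻))‖
≤ ∫_a^b k (v_i s) ds` — own-collision jumps in a plain `collisionSum`, flight terms bounded by the
transport integral (`collisionSum_ite_fst_posVel_eq_collisionalTransfer` and
`norm_sub_sub_collisionalTransfer_le`). -/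
theorem norm_sub_sub_collisionSum_le [T2Space X] (h : IsHardSphereTrajectory G ε n γ)
    (hG : G.IsHardSphereRegular ε) (f : X → EuclideanSpace ℝ d → E)
    {k : EuclideanSpace ℝ d → ℝ}
    (hk : ∀ (x : X) (v : EuclideanSpace ℝ d) (t : ℝ), 0 ≤ t →
      ‖f (G.translate x (t • v)) v - f x v‖ ≤ t * k v)
    (i : Fin n) {a b : ℝ} (hab : a ≤ b) :
    ‖f (γ b i).1 (γ b i).2 - f (γ a i).1 (γ a i).2 -
        collisionSum G ε γ (Ioc a b)
          (fun c => if c.fst = i then f c.fstPos c.postVel.1 - f c.fstPos c.preVel.1 else 0)‖ ≤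
      ∫ s in a..b, k (γ s i).2 := by
  rw [collisionSum_ite_fst_posVel_eq_collisionalTransfer h hG f i a b]
  exact norm_sub_sub_collisionalTransfer_le h hG.continuous_translate_left f hk i hab

end Trajectory

/-! ## On the flat torus `𝕋³` along the hard-sphere flow -/

/-- A translate of a point of the flat torus by `proj a` is at (sup-)distance at most `‖a‖` from
it: each coordinate of `proj a` is the class of `a k` in `ℝ/ℤ`, of quotient norm `≤ |a k| ≤ ‖a‖`. -/
theorem dist_add_proj_self_le {d : Type*} [Fintype d] (x : UnitAddTorus d)
    (a : EuclideanSpace ℝ d) :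
    dist (x + Literature.Analysis.FunctionSpaces.Torus.proj a) x ≤ ‖a‖ := by
  rw [dist_eq_norm, add_sub_cancel_left, pi_norm_le_iff_of_nonneg (norm_nonneg a)]
  intro k
  rw [Literature.Analysis.FunctionSpaces.Torus.proj_apply]
  have h1 : ‖((a k : ℝ) : UnitAddCircle)‖ ≤ |a k| := by
    rw [UnitAddCircle.norm_eq]
    simpa using round_le (a k) 0
  have h2 : |a k| ≤ ‖a‖ := by simpa using PiLp.norm_apply_le a k
  exact h1.trans h2

/-- A modulus `K v` of a `dist`-Lipschitz estimate in the position variable on `𝕋³` is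
nonnegative (the torus has two points at positive distance). -/
theorem nonneg_of_abs_sub_le_mul_dist {f : T3 → V3 → ℝ} {K : V3 → ℝ}
    (hK : ∀ (x x' : T3) (v : V3), |f x v - f x' v| ≤ K v * dist x x') (v : V3) : 0 ≤ K v := by
  set P : T3 := fun _ => (((1 : ℝ) / 2 : ℝ) : UnitAddCircle) with hP
  have hq : ‖(((1 : ℝ) / 2 : ℝ) : UnitAddCircle)‖ = 1 / 2 := by
    rw [AddCircle.norm_half_period_eq, abs_one]
  have hd : 0 < dist P 0 := by
    rw [dist_zero_right]
    refine lt_of_lt_of_le (by norm_num : (0 : ℝ) < 1 / 2) ?_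
    rw [← hq]
    exact norm_le_pi_norm P 0
  exact nonneg_of_mul_nonneg_left ((abs_nonneg _).trans (hK P 0 v)) hd

/-- **Position–velocity telescoping along the hard-sphere flow on `𝕋³`, with the Lipschitz bound
of the flight terms** (registered helper of the line `birth`; the pathwise transport estimate of the
corrector identity (★) of `stub_correctorTransfer`). For reduced diameter `0 < σ < 1/2`, a flow
`Φ` of `N + 1` spheres, a GOOD initial datum `z`, a functional `f : T3 → V3 → ℝ` of position and
velocity which is Lipschitz in the position with a velocity-dependent modulus,
`|f x v - f x' v| ≤ K v · dist x x'` (instance metric of `𝕋³`; no regularity in `v`, no sign or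
growth condition on `K`), every particle `i` and all times `a ≤ b`:

  `|f (x_i b) (v_i b) - f (x_i a) (v_i a) - Σ_{records c in (a, b], fst = i}
      (f (x_c, v⁺) - f (x_c, v⁻))| ≤ ∫_a^b K (v_i t) ‖v_i t‖ dt`,

`x_c = c.fstPos` the position of `i` at its own collision. The own-collision jumps are a plain
`collisionSum` (to be split into retained / non-retained records by the pair clamps); what is left —
the sum over the free flights of `i` of `f (x_end, v) - f (x_start, v)` — is bounded flight by
flight by `K v · dist (x_end, x_start) ≤ K v ‖v‖ · (length)`, since a free flight of duration `t`
displaces by `dist (x + proj (t • v), x) ≤ t ‖v‖` (`dist_add_proj_self_le`). The integrand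
`t ↦ K (v_i t) ‖v_i t‖` is interval integrable for every `K` (`ccb7_comp_vel_intervalIntegrable`). -/
theorem ccb7_posvel_telescope_le : ∀ (σ : ℝ), 0 < σ → σ < 2⁻¹ → ∀ (N : ℕ)
    (Φ : HardSphereFlow (Torus.geometry (Fin 3)) (hsDiameter σ N) (N + 1))
    (z : Config (N + 1) (Fin 3) T3), z ∈ Φ.good → ∀ (f : T3 → V3 → ℝ) (K : V3 → ℝ),
    (∀ (x x' : T3) (v : V3), |f x v - f x' v| ≤ K v * dist x x') →
    ∀ (i : Fin (N + 1)) (a b : ℝ), a ≤ b →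
    |f (Φ.flow b z i).1 (Φ.flow b z i).2 - f (Φ.flow a z i).1 (Φ.flow a z i).2 -
        Φ.collisionSum (Set.Ioc a b)
          (fun c => if c.fst = i then f c.fstPos c.postVel.1 - f c.fstPos c.preVel.1 else 0) z| ≤
      ∫ t in a..b, K (Φ.flow t z i).2 * ‖(Φ.flow t z i).2‖ := by
  intro σ hσ hσ2 N Φ z hz f K hK i a b hab
  have hG : (Torus.geometry (Fin 3)).IsHardSphereRegular (hsDiameter σ N) :=
    Torus.isHardSphereRegular_geometry ((hsDiameter_le hσ.le N).trans_lt hσ2)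
  have hk : ∀ (x : T3) (v : V3) (t : ℝ), 0 ≤ t →
      ‖f ((Torus.geometry (Fin 3)).translate x (t • v)) v - f x v‖ ≤ t * (K v * ‖v‖) := by
    intro x v t ht
    rw [Torus.geometry_translate, Real.norm_eq_abs]
    refine (hK _ _ v).trans ?_
    calc K v * dist (x + Literature.Analysis.FunctionSpaces.Torus.proj (t • v)) x
        ≤ K v * ‖t • v‖ :=
          mul_le_mul_of_nonneg_left (dist_add_proj_self_le x (t • v))
            (nonneg_of_abs_sub_le_mul_dist hK v)
      _ = t * (K v * ‖v‖) := by
          rw [norm_smul, Real.norm_of_nonneg ht]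
          ring
  have h := norm_sub_sub_collisionSum_le (Φ.isTrajectory z hz) hG f hk i hab
  rw [Real.norm_eq_abs] at h
  simpa only [HardSphereFlow.collisionSum_eq] using h

/-- **Every function of one velocity is interval integrable along a good orbit of the hard-sphere
flow on `𝕋³`** (registered helper of the line `birth`). For a flow `Φ` of `N + 1` spheres, a good
initial datum `z`, EVERY `g : V3 → ℝ` (no measurability, continuity or growth condition), every
particle `i` and all `a, b`: `t ↦ g (v_i t)` is interval integrable on `[a, b]` — the velocity of
`i` along the orbit is piecewise constant with finitely many jumps in bounded windows
(`intervalIntegrable_comp_vel`). With `g v = K v ‖v‖` this is the integrand of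
`ccb7_posvel_telescope_le`; summed over `i` it makes the transport term of the corrector identity
an honest time integral. -/
theorem ccb7_comp_vel_intervalIntegrable : ∀ (σ : ℝ) (N : ℕ)
    (Φ : HardSphereFlow (Torus.geometry (Fin 3)) (hsDiameter σ N) (N + 1))
    (z : Config (N + 1) (Fin 3) T3), z ∈ Φ.good → ∀ (g : V3 → ℝ) (i : Fin (N + 1)) (a b : ℝ),
    IntervalIntegrable (fun t => g (Φ.flow t z i).2) MeasureTheory.volume a b := by
  intro σ N Φ z hz g i a b
  exact intervalIntegrable_comp_vel (Φ.isTrajectory z hz) g i a b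

end Summit.AtomisticToContinuum.HydrodynamicLimit.Theorems.ClampedCorrectorBirth
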